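import Summits.ResolutionOfSingularities.ResolutionOfSingularities.Theorems.MarkedTransferCampaignW46ThreefoldsGammaFreeGlobalMeasureStep
import Summits.ResolutionOfSingularities.ResolutionOfSingularities.Theorems.MarkedTransferCampaignW46ThreefoldsGammaFreeGlobalSNCEnd
import Summits.ResolutionOfSingularities.ResolutionOfSingularities.Theorems.MarkedTransferCampaignW46ThreefoldsGammaFreeGlobalSNCTransport
import Summits.ResolutionOfSingularities.ResolutionOfSingularities.Theorems.MarkedTransferCampaignW46ThreefoldsGammaFreeGlobalCurves
import Literature.AlgebraicGeometry.Resolution.AlterationsBoundarySmoothLocus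
import Literature.AlgebraicGeometry.Resolution.QuasiExcellentSchemes
import Literature.AlgebraicGeometry.Resolution.ExcellentRingsFieldProofs
import Literature.AlgebraicGeometry.Hironaka2017.PermissibleLSB
import Literature.AlgebraicGeometry.Resolution.ColonIdealSheafFG
import Literature.AlgebraicGeometry.Resolution.BlowupsProduct
import Literature.AlgebraicGeometry.Resolution.RegularCentreBlowupSeqIntegral
import Literature.AlgebraicGeometry.Resolution.MarkedIdealsLemmas
import Literature.AlgebraicGeometry.Resolution.BirationalDimensionInequality
import HarnessLib

/-!
# [OURS · L1 W4.6 rung (ii-2)] THE SURFACE RUNG OF THE DIMENSION LADDER — `GammaFreeGlobalOrderReductionDimLE p 2`, PROVED: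
# Γ-free global order reduction of an effective Cartier ideal on a regular surface over a perfect field

Cell res-hironaka, LADDER-RESOLUTION rung L (D-0089), slot W4.6, rung (ii) (dimension ladder, res-L1-type-o1 p496755: ladder module
`MarkedTransferCampaignW46ThreefoldsGammaFreeGlobalLadder`, rungs (ii-1) `d = 1` res-L1-s46-pv-10 — landed — and (ii-2) `d = 2`
THIS FILE); seat res-D-pv-049 AS res-L1-s46-pv-11 (holder of rung (ii-2)). Host route MarkedTransfer, host item
`HypersurfaceOrderReductionDimLeThree` (stmt-ResolutionOfSingularities-16156): proposed `--kind proof --supports` it `--as helper`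
(the statement of record is the `d = 3` rung; this file closes `d = 2`). Everything here is OURS; nothing of H. Hironaka's manuscript
[Hironaka2017] is asserted. AI-written; AI review is weaker than expert review.

## What is proved

* `controlledTransform_ne_bot_and_isEffectiveCartier_point` — blowing up a closed point of order `≥ m` of an effective Cartier
  `I ≠ 0` on a regular scheme, the controlled transform `(I𝒪_{X′} : 𝓘_E^m)` is again a non-zero effective Cartier ideal
  (`𝓘_E^m · I′ = I𝒪_{X′}`, Stacks 07ZV / Kollár 3.60).
* `orderReducible_of_primeDivisorFamily` — **the `d = 2` loop**: for a regular integral surface `X` of finite type over a field,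
  an effective Cartier `I ≠ 0`, `m ≥ 1`, and a prime-divisor family presenting `V(I)` (brick B10a), `OrderReducible I m` — by
  well-founded induction on the measure `(Δ, Σ(i−1), Σ(k−2)⁺) ∈ ℕ∞ ×ₗ ℕ ×ₗ ℕ`: either every point of `Sing(I, m)` is an snc point
  of the boundary — then the boundary has simple normal crossings on the open complement `U ⊇ Sing(I, m)` of the finite non-snc
  set (bricks B11b res-D-pv-039, B11a res-D-pv-041) and the monomial end-game (brick B7, over res-L1-s46-pv-3's (ii-M)) concludes —
  or a non-snc point `x ∈ Sing(I, m)` is blown up (a permissible centre: a closed point inside `Sing(I, m)`), the measure drops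
  (brick B10b) and the induction hypothesis applies to the controlled transform (`OrderReducible.of_blowup`).
* `gammaFreeGlobalDimLE_two` — **RUNG (ii-2) `GammaFreeGlobalOrderReductionDimLE p 2`**: dimension `≤ 1` is rung (ii-1)
  (res-D-pv-047 AS res-L1-s46-pv-10, `orderReducible_of_dim_le_one`); dimension `2` is the loop, entered through brick B10a.

## Sources

* R. Hartshorne, *Algebraic Geometry* (1977), Ch. V Thm. 3.9, Prop. 3.8 (embedded resolution of curves in surfaces by blowing up
  points; the measure). [Hartshorne1977]
* J. Kollár, *Lectures on Resolution of Singularities* (2007), Thm. 1.47, §1.4, 3.60. [Kollar2007]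
* The Stacks Project, Tags 07ZV, 02OS, 07QW. [StacksProject]
* H. Hironaka, ms. 2017-03-23, Def. 2.1 p.5, Rem. 2.6 p.6 — scope only (the `d = 2` rung of the campaign's dimension ladder),
  under adjudication, not cited as fact. [Hironaka2017]
-/

noncomputable section

set_option linter.dupNamespace false -- mandated namespace of this single-conjunct summit

open CategoryTheory AlgebraicGeometry TopologicalSpace IsLocalRing Topology

namespace Summit.ResolutionOfSingularities.ResolutionOfSingularities.Theorems

namespace CampaignW46

open Literature.AlgebraicGeometry.Resolution
open Literature.AlgebraicGeometry.Hironaka2017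
open Scheme.IdealSheafData

universe u

/-! ## The controlled transform of an effective Cartier ideal under the blowing up of a point of `Sing(I, m)` -/

/-- **Blowing up a closed point of order `≥ m`, the controlled transform of an effective Cartier `I ≠ 0` is a non-zero effective
Cartier ideal**: `I ≤ 𝓘_{x}^m` (the order condition), so `𝓘_E^m · I′ = I𝒪_{X′}` with `I𝒪_{X′}` effective Cartier and non-zero.
[cite: StacksProject, Tag 07ZV] [cite: Kollar2007, 3.60] -/
theorem controlledTransform_ne_bot_and_isEffectiveCartier_point {X X' : Scheme.{u}} [IsIntegral X] [IsLocallyNoetherian X]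
    (hX : Scheme.IsRegular X) {x : X} (hx : IsClosed ({x} : Set X)) (hxne : ({x} : Set X) ≠ Set.univ) {π : X' ⟶ X}
    (hπ : IsBlowup π (vanishingIdeal ⟨{x}, hx⟩)) {I : X.IdealSheafData} (hI : I ≠ ⊥) (hIc : IsEffectiveCartier I) {m : ℕ}
    (hm : (m : ℕ∞) ≤ idealOrder I x) :
    controlledTransform π (vanishingIdeal ⟨{x}, hx⟩) I m ≠ ⊥ ∧
      IsEffectiveCartier (controlledTransform π (vanishingIdeal ⟨{x}, hx⟩) I m) := by
  have hle : I ≤ vanishingIdeal ⟨{x}, hx⟩ ^ m :=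
    le_vanishingIdeal_pow_of_forall_le_idealOrder hX (isRegular_subscheme_vanishingIdeal_singleton hx) fun y hy => by
      rw [show y = x from hy]; exact hm
  have hprod := hπ.pow_mul_controlledTransform_eq (comap_le_comap_pow_of_le_pow hle π)
  have hcomap : IsEffectiveCartier (I.comap π) := IsEffectiveCartier.comap_of_isBlowup hπ hIc
  have hne : I.comap π ≠ ⊥ := by
    refine hπ.comap_ne_bot (fun h => hxne ?_) hI
    have := congrArg (fun Z : Closeds X => (Z : Set X)) h
    simpa [coe_support_vanishingIdeal] using this
  refine ⟨fun h => hne ?_, ?_⟩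
  · rw [← hprod, h, mul_bot]
  · rw [← hprod] at hcomap
    exact hcomap.of_mul_right

/-! ## The `d = 2` loop -/

/-- In `WithBot ℕ∞`: `d ≤ 2` and `¬ d ≤ 1` force `d = 2`. [folklore] -/
theorem withBotENat_eq_two {d : WithBot ℕ∞} (h2 : d ≤ 2) (h1 : ¬ d ≤ 1) : d = 2 := by
  induction d using WithBot.recBotCoe with
  | bot => exact absurd bot_le h1
  | coe a =>
    induction a using ENat.recTopCoe with
    | top =>
      exfalso
      have h : ((⊤ : ℕ∞) : WithBot ℕ∞) ≤ ((2 : ℕ∞) : WithBot ℕ∞) := by simpa using h2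
      rw [WithBot.coe_le_coe, top_le_iff] at h
      exact absurd h (by exact_mod_cast ENat.coe_ne_top 2)
    | coe n =>
      have h2' : ((n : ℕ∞) : WithBot ℕ∞) ≤ ((2 : ℕ∞) : WithBot ℕ∞) := by simpa using h2
      have h2'' : (n : ℕ∞) ≤ 2 := WithBot.coe_le_coe.mp h2'
      have h3 : n ≤ 2 := by exact_mod_cast h2''
      have h1' : ¬ n ≤ 1 := fun h => h1 (by exact_mod_cast h)
      have : n = 2 := by omega
      subst this; rfl

/-- **[OURS · W4.6 rung (ii-2)] THE `d = 2` LOOP.** For a field `k`, `m ≥ 1` and a value `μ` of the measure: every regular integral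
Noetherian `k`-scheme `X` locally of finite type with `topologicalKrullDim X = 2`, every effective Cartier `I ≠ 0` on it and every
prime-divisor family of `V(I)` of measure `μ` has `OrderReducible I m`. Well-founded induction on `μ ∈ ℕ∞ ×ₗ ℕ ×ₗ ℕ`; see the
module docstring. [cite: Hartshorne1977, Ch. V Thm. 3.9] -/
theorem orderReducible_of_primeDivisorFamily {k : Type u} [Field k] {m : ℕ} (hm : 1 ≤ m) (μ : ℕ∞ ×ₗ ℕ ×ₗ ℕ) :
    ∀ {ι : Type} [Finite ι] {X : Scheme.{u}} [IsIntegral X] [IsNoetherian X] (s : X ⟶ Spec (.of k))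
      [LocallyOfFiniteType s] (_ : Scheme.IsRegular X) (_ : topologicalKrullDim X = 2) {I : X.IdealSheafData} (hI : I ≠ ⊥)
      (_ : IsEffectiveCartier I) (ζ : ι → X) (C : ι → Scheme.{u}) (i : ∀ l, C l ⟶ X) (_ : Function.Injective ζ)
      (_ : Set.range ζ = divisorialPoints I)
      (hfam : ∀ l, IsClosedImmersion (i l) ∧ ∃ (_ : IsIntegral (C l)) (_ : IsNoetherian (C l)),
        Scheme.IsQuasiExcellent (C l) ∧ topologicalKrullDim (C l) ≤ 1 ∧ i l (genericPoint (C l)) = ζ l),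
      toLex (@familyDelta ι C (fun l => (hfam l).2.1), toLex (familyTangency ζ, familyExcess ζ)) = μ →
        OrderReducible I m := by
  induction μ using WellFoundedLT.induction with
  | ind μ ih =>
  intro ι _ X _ _ s _ hX hd I hI hIc ζ C i hζinj hζrange hfam hμ
  haveI : IsLocallyNoetherian X := inferInstance
  have hdim : topologicalKrullDim X ≤ 2 := hd.le
  have hXe : Scheme.IsExcellent X := Scheme.isExcellent_of_locallyOfFiniteType Stacks07QW_field_holds s
  have hXq : Scheme.IsQuasiExcellent X := hXe.isQuasiExcellent
  by_cases hall : ∀ y : X, (m : ℕ∞) ≤ idealOrder I y →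
      SNCAt (((finite_divisorialPoints hI).toFinset.toList).map primeDivisorIdeal) y
  · /- END-GAME: the boundary has simple normal crossings near `Sing(I, m)` -/
    obtain ⟨hFfin, hFcl⟩ := finite_setOf_not_sncAt_divisorial hX hXe hdim hI
    have hFclosed : IsClosed {y : X | ¬ SNCAt (((finite_divisorialPoints hI).toFinset.toList).map primeDivisorIdeal) y} := by
      rw [← Set.biUnion_of_singleton {y : X | ¬ SNCAt (((finite_divisorialPoints hI).toFinset.toList).map primeDivisorIdeal) y}]
      exact hFfin.isClosed_biUnion fun y hy => hFcl y hy
    let U : X.Opens := ⟨{y : X | ¬ SNCAt (((finite_divisorialPoints hI).toFinset.toList).map primeDivisorIdeal) y}ᶜ,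
      hFclosed.isOpen_compl⟩
    have hU : ∀ y, (m : ℕ∞) ≤ idealOrder I y → y ∈ (U : Set X) := fun y hy h => h (hall y hy)
    have hsnc := hasSNC_map_comap_ι_of_forall_sncAt (((finite_divisorialPoints hI).toFinset.toList).map primeDivisorIdeal) U
      fun y hy => by by_contra h; exact hy h
    rw [List.map_map] at hsnc
    exact orderReducible_of_hasSNC_nhds_of_isEffectiveCartier hX hXe hI hIc hm U hU hsnc
  · /- STEP: blow up a non-snc point of `Sing(I, m)` -/
    push Not at hall
    obtain ⟨x, hxm, hxsnc⟩ := hall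
    have hx : IsClosed ({x} : Set X) := (finite_setOf_not_sncAt_divisorial hX hXe hdim hI).2 x hxsnc
    have hR2 : ringKrullDim (X.presheaf.stalk x) = 2 := by rw [ringKrullDim_stalk_eq_of_isClosed s hx, hd]
    have hxne : ({x} : Set X) ≠ Set.univ := by
      intro h
      have hgen : genericPoint X ∈ ({x} : Set X) := h ▸ Set.mem_univ _
      rw [Set.mem_singleton_iff] at hgen
      have h1 : (1 : ℕ∞) ≤ idealOrder I x := le_trans (by exact_mod_cast hm) hxm
      rw [← hgen] at h1
      exact not_mem_support_genericPoint hI ((mem_support_iff_one_le_idealOrder I _).mpr h1)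
    obtain ⟨X', π, hπ⟩ := exists_isBlowup X (vanishingIdeal ⟨{x}, hx⟩)
    obtain ⟨ι', hfinι', ζ', C', i', hfam', hinj', hrange', hlt⟩ :=
      exists_family_measure_lt hX hXq hdim hx hxne hR2 hπ hI m ζ C i hζinj hζrange hfam hxsnc
    -- the new state
    haveI := hfinι'
    haveI : IsIntegral X' := hπ.isIntegral (vanishingIdeal_singleton_ne_bot hx hxne)
    haveI : IsProper π := hπ.isProper
    haveI : IsLocallyNoetherian X' := LocallyOfFiniteType.isLocallyNoetherian π
    haveI : CompactSpace X' := QuasiCompact.compactSpace_of_compactSpace π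
    haveI : IsNoetherian X' := {}
    have hX' : Scheme.IsRegular X' :=
      hπ.isRegular_of_isRegular_subscheme hX (isRegular_subscheme_vanishingIdeal_singleton hx)
    have hd' : topologicalKrullDim X' = 2 := by
      rw [← hd]
      exact (hπ.isBirational' (vanishingIdeal_singleton_ne_bot hx hxne)).topologicalKrullDim_eq_of_isProper
    obtain ⟨hI', hIc'⟩ := controlledTransform_ne_bot_and_isEffectiveCartier_point hX hx hxne hπ hI hIc hxm
    have hrec := ih _ (hμ ▸ hlt) (π ≫ s) hX' hd' hI' hIc' ζ' C' i' hinj' hrange' hfam' rfl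
    exact OrderReducible.of_blowup ⟨{x}, hx⟩ π (isRegular_subscheme_vanishingIdeal_singleton hx)
      (fun y hy => by rw [show y = x from hy]; exact hxm) hπ hrec

/-! ## Rung (ii-2) -/

/-- **[OURS · W4.6 RUNG (ii-2)] `GammaFreeGlobalOrderReductionDimLE p 2` — Γ-free global order reduction on regular surfaces over a
perfect field.** For every prime `p`, perfect field `k` of characteristic `p`, separated quasi-compact `k`-scheme `X` locally of
finite type, integral and regular, of dimension `≤ 2`, every effective Cartier `I ≠ 0` and every `m ≥ 1`: `OrderReducible I m`
(a sequence of permissible point/curve blow-ups after which `ord < m` everywhere). Dimension `≤ 1`: rung (ii-1); dimension `2`: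
the loop `orderReducible_of_primeDivisorFamily` entered through brick B10a. [cite: Hartshorne1977, Ch. V Thm. 3.9] -/
theorem gammaFreeGlobalDimLE_two (p : ℕ) : GammaFreeGlobalOrderReductionDimLE.{u} p 2 := by
  intro _ k _ _ _ X s _ hloft hqc hint hreg hdim I hI hIc m hm
  haveI := hloft
  haveI := hqc
  haveI := hint
  haveI : IsLocallyNoetherian X := LocallyOfFiniteType.isLocallyNoetherian s
  haveI : CompactSpace X := QuasiCompact.compactSpace_of_compactSpace s
  haveI : IsNoetherian X := {}
  have hdim2 : topologicalKrullDim X ≤ 2 := by exact_mod_cast hdim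
  by_cases hd1 : topologicalKrullDim X ≤ 1
  · exact orderReducible_of_dim_le_one hreg hd1 hI hm
  · have hd : topologicalKrullDim X = 2 := withBotENat_eq_two hdim2 hd1
    have hXe : Scheme.IsExcellent X := Scheme.isExcellent_of_locallyOfFiniteType Stacks07QW_field_holds s
    obtain ⟨n, ζ, C, i, hζinj, hζrange, hfam⟩ := exists_primeDivisorFamily hXe.isQuasiExcellent hdim2 hI
    exact orderReducible_of_primeDivisorFamily hm _ s hreg hd hI hIc ζ C i hζinj hζrange hfam rfl

end CampaignW46

end Summit.ResolutionOfSingularities.ResolutionOfSingularities.Theorems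

end
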